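import Literature.Geometry.Lorentzian.CompleteIsometricImmersionOnto
import Literature.Geometry.Lorentzian.MGHDUniqueness
import Literature.Geometry.Lorentzian.AdmissibleMGHDExistence
import Literature.Geometry.Lorentzian.MinkowskiCauchyDevelopment
import Literature.Geometry.Lorentzian.CauchyProblemProofs
import Literature.Geometry.Lorentzian.TrivialDataAdmissible
import HarnessLib

/-!
# A geodesically complete Cauchy development is maximal; Minkowski space is the MGHD of trivial data

Certifying maximality (`VacuumCauchyDevelopment.IsMaximal`: every vacuum Cauchy development of
the same data embeds into it) of an explicitly given development is the step that turns a model
spacetime into an instance of the hypotheses of the conjectures of summit `FinalStateConjecture`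
(all of which quantify over maximal developments). This file proves the classical criterion:

* `DataEmbedding.surjective_of_isGeodesicallyComplete` /
  `DataEmbedding.EmbedsInto.isIsometricTo_of_isGeodesicallyComplete` — **an embedding of a
  geodesically complete data embedding into another one (same data) is onto, hence an isometry of
  developments**: the spacetime of a data embedding is connected, so O'Neill's completeness
  criterion applies (O'Neill 1983, Ch. 7, Thm. 7.28 and Cor. 7.29:
  `IsIsometricImmersion.surjective_of_isGeodesicallyComplete`), and a bijective local
  diffeomorphism is a diffeomorphism (`IsLocalDiffeomorph.diffeomorphOfBijective`);
* `VacuumCauchyDevelopment.IsMaximal.isIsometricTo_of_isGeodesicallyComplete` — **every maximal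
  vacuum Cauchy development is isometric to any geodesically complete one** (unconditionally: the
  complete one embeds into the maximal one by maximality, and the embedding is onto);
* `VacuumCauchyDevelopment.isMaximal_of_isGeodesicallyComplete_of_exists` — **a geodesically
  complete vacuum Cauchy development is maximal as soon as some maximal development of its data
  exists**; with the Choquet-Bruhat–Geroch existence theorem (the named fact
  `choquetBruhat_geroch_exists_mghd_cauchy`, `CauchyProblemMGHDExistence.lean`) this is
  `VacuumCauchyDevelopment.isMaximal_of_isGeodesicallyComplete` (vacuum constraint solutions on a
  connected Hausdorff second countable `3`-manifold) and `…_of_mem_admissibleVacuumData`;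
* `Minkowski.isIsometricTo_vacuumCauchyDevelopment_of_isMaximal`,
  `Minkowski.isMaximal_vacuumCauchyDevelopment` — **Minkowski space `(ℝ⁴, η)` with the slice
  `{t = 0}` is the maximal globally hyperbolic vacuum development of the trivial data
  `(ℝ³, δ, 0)`**: unconditionally, every maximal development of the trivial data is isometric to
  it; under `choquetBruhat_geroch_exists_mghd_cauchy`, it is itself maximal
  (`minkowski_isGeodesicallyComplete_holds`, O'Neill 1983, Ch. 3, Ex. 3.25).

Sources. Choquet-Bruhat–Geroch, Comm. Math. Phys. 14 (1969) 329–335, Thm. 3 and p. 334 (the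
maximal development is an extension of every development; uniqueness up to isometry);
Ringström, *The Cauchy Problem in General Relativity* (2009), Ch. 16 (maximal globally hyperbolic
developments; Minkowski space as the development of trivial data, Example before Thm. 16.6);
O'Neill 1983, Ch. 7, Cor. 7.29 (completeness and coverings). The statement "a geodesically
complete globally hyperbolic development is the MGHD" is the standard corollary of CBG uniqueness
used, e.g., in the stability-of-Minkowski literature to identify the maximal development of small
data with the constructed complete solution (Lindblad–Rodnianski, Ann. of Math. 171 (2010),
Thm. 1.1 and §2). Everything here is proved; no definitions and no named facts are introduced.

## References

* Y. Choquet-Bruhat, R. Geroch, *Global aspects of the Cauchy problem in general relativity*,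
  Comm. Math. Phys. 14 (1969) 329–335, Thm. 3. Key `ChoquetBruhatGeroch1969CMP`.
* H. Ringström, *The Cauchy Problem in General Relativity*, EMS 2009, Ch. 16, Def. 16.5,
  Thm. 16.6. Key `Ringstrom2009`.
* B. O'Neill, *Semi-Riemannian geometry with applications to relativity*, Academic Press 1983,
  Ch. 7, Thm. 7.28, Cor. 7.29; Ch. 3, Ex. 3.25. Key `ONeillSemiRiemannian1983`.
-/

noncomputable section

open Set Function
open scoped Manifold ContDiff Topology

namespace Literature.Geometry.Lorentzian

universe u

section Developments

variable {n : ℕ} {X : Type u} [TopologicalSpace X] [ChartedSpace (EuclideanSpace ℝ (Fin n)) X]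
  [IsManifold (𝓡 n) ∞ X] [ConnectedSpace X] {D : InitialDataSet (𝓡 n) X}

namespace DataEmbedding

/-- **An isometric immersion of a geodesically complete data embedding into another one is onto**
(O'Neill 1983, Ch. 7, Thm. 7.28 and Cor. 7.29, for the connected target spacetime; geodesic
completeness of the source is quantified over the standing Levi-Civita instance, as in
`minkowski_isGeodesicallyComplete`). [cite: ONeillSemiRiemannian1983, Ch. 7, Cor. 7.29] -/
theorem surjective_of_isGeodesicallyComplete {𝒮₁ 𝒮₂ : DataEmbedding D}
    {ψ : 𝒮₁.carrier → 𝒮₂.carrier}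
    (hψ : 𝒮₁.metric.IsIsometricImmersion 𝒮₂.metric.toPseudoRiemannianMetric ψ)
    (hc : ∀ [𝒮₁.metric.toPseudoRiemannianMetric.HasLeviCivita],
      IsGeodesicallyComplete 𝒮₁.metric.toPseudoRiemannianMetric.leviCivita) :
    Surjective ψ := by
  haveI := 𝒮₁.metric.toPseudoRiemannianMetric.hasLeviCivita
  haveI := 𝒮₂.metric.toPseudoRiemannianMetric.hasLeviCivita
  haveI : CovariantDerivative.ContMDiffCovariantDerivative
      𝒮₁.metric.toPseudoRiemannianMetric.leviCivita 1 :=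
    ⟨𝒮₁.metric.isLocallyContMDiff_leviCivita_holds 1 (by exact_mod_cast le_top) univ isOpen_univ⟩
  haveI : CovariantDerivative.ContMDiffCovariantDerivative
      𝒮₂.metric.toPseudoRiemannianMetric.leviCivita 1 :=
    ⟨𝒮₂.metric.isLocallyContMDiff_leviCivita_holds 1 (by exact_mod_cast le_top) univ isOpen_univ⟩
  haveI := Literature.Geometry.Riemannian.contMDiffCovariantDerivative_leviCivita_infty
    𝒮₂.metric.toPseudoRiemannianMetric le_rfl
  haveI : Nonempty 𝒮₁.carrier := ⟨𝒮₁.embed (Classical.arbitrary X)⟩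
  exact hψ.surjective_of_isGeodesicallyComplete rfl hc

/-- **An embedding of a geodesically complete data embedding into another one (same data) is an
isometry of developments**: the witness `ψ` is onto (`surjective_of_isGeodesicallyComplete`), a
bijective local diffeomorphism, hence a diffeomorphism, isometric, time-orientation preserving and
commuting with the embeddings of the data. Choquet-Bruhat–Geroch 1969, p. 334; Ringström 2009,
Ch. 16. [cite: ChoquetBruhatGeroch1969CMP, Thm. 3 (p. 334)] -/
theorem EmbedsInto.isIsometricTo_of_isGeodesicallyComplete {𝒮₁ 𝒮₂ : DataEmbedding D}
    (h : 𝒮₁.EmbedsInto 𝒮₂)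
    (hc : ∀ [𝒮₁.metric.toPseudoRiemannianMetric.HasLeviCivita],
      IsGeodesicallyComplete 𝒮₁.metric.toPseudoRiemannianMetric.leviCivita) :
    𝒮₁.IsIsometricTo 𝒮₂ := by
  obtain ⟨ψ, -, hψo, hψi, hψτ, hψι⟩ := h
  have hbij : Bijective ψ := ⟨hψo.injective, surjective_of_isGeodesicallyComplete hψi hc⟩
  set Φ := (hψi.isLocalDiffeomorph rfl).diffeomorphOfBijective hbij with hΦ_def
  have hΦ : (Φ : 𝒮₁.carrier → 𝒮₂.carrier) = ψ := rfl
  refine ⟨Φ, ?_, ?_, ?_⟩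
  · intro y
    rw [hΦ]
    exact hψi.2 y
  · intro y
    rw [hΦ]
    exact hψτ y
  · rw [hΦ]
    exact hψι

end DataEmbedding

namespace VacuumCauchyDevelopment

/-- **Every maximal vacuum Cauchy development is isometric to any geodesically complete one**
(unconditional): the complete development `𝒟` embeds into the maximal `𝒟₀` by maximality, and
that embedding is an isometry of developments
(`DataEmbedding.EmbedsInto.isIsometricTo_of_isGeodesicallyComplete`). Choquet-Bruhat–Geroch
1969, Thm. 3; Ringström 2009, Thm. 16.6. [cite: ChoquetBruhatGeroch1969CMP, Thm. 3 (pp. 332–334)] -/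
theorem IsMaximal.isIsometricTo_of_isGeodesicallyComplete {𝒟₀ 𝒟 : VacuumCauchyDevelopment D}
    (h₀ : 𝒟₀.IsMaximal)
    (hc : ∀ [𝒟.metric.toPseudoRiemannianMetric.HasLeviCivita],
      IsGeodesicallyComplete 𝒟.metric.toPseudoRiemannianMetric.leviCivita) :
    𝒟.toCauchyDevelopment.IsIsometricTo 𝒟₀.toCauchyDevelopment :=
  DataEmbedding.EmbedsInto.isIsometricTo_of_isGeodesicallyComplete (h₀ 𝒟) hc

/-- **A geodesically complete vacuum Cauchy development is maximal as soon as some maximal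
development of its data exists** (it is isometric to that one,
`IsMaximal.isIsometricTo_of_isGeodesicallyComplete`, and maximality is invariant under isometry of
developments, `IsMaximal.of_isIsometricTo`). Choquet-Bruhat–Geroch 1969, Thm. 3; Ringström 2009,
Ch. 16. [cite: ChoquetBruhatGeroch1969CMP, Thm. 3 (pp. 332–334)] -/
theorem isMaximal_of_isGeodesicallyComplete_of_exists {𝒟 : VacuumCauchyDevelopment D}
    (hc : ∀ [𝒟.metric.toPseudoRiemannianMetric.HasLeviCivita],
      IsGeodesicallyComplete 𝒟.metric.toPseudoRiemannianMetric.leviCivita)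
    (hex : ∃ 𝒟₀ : VacuumCauchyDevelopment D, 𝒟₀.IsMaximal) : 𝒟.IsMaximal := by
  obtain ⟨𝒟₀, h₀⟩ := hex
  exact h₀.of_isIsometricTo (h₀.isIsometricTo_of_isGeodesicallyComplete hc).symm

/-- **Given the maximal development, geodesically complete ⟺ … ⟹ the two coincide**: a
geodesically complete vacuum Cauchy development into which a maximal one embeds — or which embeds
into a maximal one — is maximal; recorded as the equivalence `𝒟.IsMaximal ↔ ∃ 𝒟₀, 𝒟₀.IsMaximal`
for complete `𝒟`. Choquet-Bruhat–Geroch 1969, Thm. 3. [cite: ChoquetBruhatGeroch1969CMP, Thm. 3 (pp. 332–334)] -/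
theorem isMaximal_iff_exists_of_isGeodesicallyComplete {𝒟 : VacuumCauchyDevelopment D}
    (hc : ∀ [𝒟.metric.toPseudoRiemannianMetric.HasLeviCivita],
      IsGeodesicallyComplete 𝒟.metric.toPseudoRiemannianMetric.leviCivita) :
    𝒟.IsMaximal ↔ ∃ 𝒟₀ : VacuumCauchyDevelopment D, 𝒟₀.IsMaximal :=
  ⟨fun h ↦ ⟨𝒟, h⟩, isMaximal_of_isGeodesicallyComplete_of_exists hc⟩

end VacuumCauchyDevelopment

end Developments

/-! ### Dimension `3 + 1`: the Choquet-Bruhat–Geroch theorem supplies the maximal development -/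

section CBG

variable {X : Type} [TopologicalSpace X] [ChartedSpace E3 X] [IsManifold (𝓡 3) ∞ X]
  [T2Space X] [SecondCountableTopology X] [ConnectedSpace X] {D : InitialDataSet (𝓡 3) X}

/-- **A geodesically complete vacuum Cauchy development of constraint-solving data is maximal**
(given the Choquet-Bruhat–Geroch existence theorem `choquetBruhat_geroch_exists_mghd_cauchy`,
which supplies a maximal development to compare with). Choquet-Bruhat–Geroch 1969, Thm. 3;
Ringström 2009, Thm. 16.6. [cite: ChoquetBruhatGeroch1969CMP, Thm. 3 (pp. 332–334)] -/
theorem VacuumCauchyDevelopment.isMaximal_of_isGeodesicallyComplete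
    (hcbg : choquetBruhat_geroch_exists_mghd_cauchy) [D.metric.HasLeviCivita]
    (hD : D.IsVacuumConstraintSolution) {𝒟 : VacuumCauchyDevelopment D}
    (hc : ∀ [𝒟.metric.toPseudoRiemannianMetric.HasLeviCivita],
      IsGeodesicallyComplete 𝒟.metric.toPseudoRiemannianMetric.leviCivita) : 𝒟.IsMaximal :=
  VacuumCauchyDevelopment.isMaximal_of_isGeodesicallyComplete_of_exists hc
    (hcbg.exists_isMaximal D hD)

/-- **A geodesically complete vacuum Cauchy development of an admissible datum is maximal**
(given `choquetBruhat_geroch_exists_mghd_cauchy`; the admissible class of Christodoulou 1999,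
`admissibleVacuumData X`). Choquet-Bruhat–Geroch 1969, Thm. 3. [cite: ChoquetBruhatGeroch1969CMP, Thm. 3 (pp. 332–334)] -/
theorem VacuumCauchyDevelopment.isMaximal_of_isGeodesicallyComplete_of_mem_admissibleVacuumData
    (hcbg : choquetBruhat_geroch_exists_mghd_cauchy) (hD : D ∈ admissibleVacuumData X)
    {𝒟 : VacuumCauchyDevelopment D}
    (hc : ∀ [𝒟.metric.toPseudoRiemannianMetric.HasLeviCivita],
      IsGeodesicallyComplete 𝒟.metric.toPseudoRiemannianMetric.leviCivita) : 𝒟.IsMaximal :=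
  VacuumCauchyDevelopment.isMaximal_of_isGeodesicallyComplete_of_exists hc
    (hcbg.exists_isMaximal_of_mem_admissibleVacuumData hD)

end CBG

/-! ### Minkowski space is the maximal development of the trivial data -/

namespace Minkowski

/-- **Every maximal vacuum Cauchy development of the trivial data `(ℝ³, δ, 0)` is isometric, as a
development, to Minkowski space** `Minkowski.vacuumCauchyDevelopment` (unconditionally: Minkowski
space is geodesically complete, `minkowski_isGeodesicallyComplete_holds`, O'Neill 1983, Ch. 3,
Ex. 3.25, so its embedding into the maximal development is onto). Ringström 2009, Ch. 16;
Choquet-Bruhat–Geroch 1969, Thm. 3. [cite: Ringstrom2009, Thm. 16.6] -/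
theorem isIsometricTo_vacuumCauchyDevelopment_of_isMaximal
    {𝒟₀ : VacuumCauchyDevelopment trivialData} (h₀ : 𝒟₀.IsMaximal) :
    vacuumCauchyDevelopment.toCauchyDevelopment.IsIsometricTo 𝒟₀.toCauchyDevelopment :=
  h₀.isIsometricTo_of_isGeodesicallyComplete @minkowski_isGeodesicallyComplete_holds

/-- **Minkowski space is a maximal globally hyperbolic vacuum development of the trivial data iff
the trivial data has one** (unconditional form). [cite: Ringstrom2009, Thm. 16.6] -/
theorem isMaximal_vacuumCauchyDevelopment_iff :
    vacuumCauchyDevelopment.IsMaximal ↔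
      ∃ 𝒟₀ : VacuumCauchyDevelopment trivialData, 𝒟₀.IsMaximal :=
  VacuumCauchyDevelopment.isMaximal_iff_exists_of_isGeodesicallyComplete
    @minkowski_isGeodesicallyComplete_holds

/-- **Minkowski space `(ℝ⁴, η)`, with the slice `{t = 0}`, is the maximal globally hyperbolic
vacuum development of the trivial data `(ℝ³, δ, 0)`** (given the Choquet-Bruhat–Geroch existence
theorem `choquetBruhat_geroch_exists_mghd_cauchy`; the trivial data is admissible,
`trivialData_mem_admissibleVacuumData`). Ringström 2009, Ch. 16; Choquet-Bruhat–Geroch 1969,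
Thm. 3; Hawking–Ellis 1973, §5.1. [cite: Ringstrom2009, Thm. 16.6] -/
theorem isMaximal_vacuumCauchyDevelopment (hcbg : choquetBruhat_geroch_exists_mghd_cauchy) :
    vacuumCauchyDevelopment.IsMaximal :=
  VacuumCauchyDevelopment.isMaximal_of_isGeodesicallyComplete_of_mem_admissibleVacuumData hcbg
    trivialData_mem_admissibleVacuumData @minkowski_isGeodesicallyComplete_holds

end Minkowski

end Literature.Geometry.Lorentzian

end
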